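import Summits.CriticalPhenomena.PercolationContinuityZ3.Theorems.PercNearOneGluingNoHeavyLowerTailSahiCombSubcube

/-!
# `NoHeavyLowerTail` (crux stmt-CriticalPhenomena-4575), Sahi's `C₃` at the comb level: the JUNTA-INTERSECTION theorem, dimension-free —
# if `A ∩ B` is determined by a set `W` of coordinates on which (M⁺-3) is known, then (M⁺-3) holds for `(U, A, B)` for EVERY increasing `U`

Support file (cell `prim-l12`, seat P3, gen 2; `--supports stmt-CriticalPhenomena-4575`).  No `sorry`, no named facts, standard axioms.

The chain (all comb level, i.e. statements about `CombPos (fun _ => 3) (p ↦ E₃(μ_p; 1_U,1_A,1_B))`):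
1. DOMINATION (`…SahiCombDomination`): `E₃(U,A,B) ≽ E₃(U,A^D,B^D)` where `X^D = secUnion D X`, `D = Wᶜ`, as soon as
   `A^D ∩ B^D = A ∩ B` — which holds exactly when `A ∩ B` is determined by `W` (`secUnion_eq_self_of_determinedBy`).  The enlarged pair
   `A^D, B^D` is determined by `W`.
2. PEELING THE FREE SLOT (`combPos_sahiE_three_of_determinedBy_pair`): for `A', B'` determined by `W` and ANY increasing `U`, condition on the
   coordinates outside `W` one at a time: `E₃(U,A',B') = p_e·E₃(U^{e←1},A',B') + (1−p_e)·E₃(U^{e←0},A',B')` (`sahiE_three_peel`, first-slot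
   linearity; the sections of `U` are increasing and the two pieces ignore `p_e`), so comb positivity reduces to the case where `U` is
   `W`-determined as well.
3. SUB-CUBE TRANSPORT (`…SahiCombSubcube.combPos_sahiE_three_of_determinedBy_all`): a triple of `W`-determined events is the pull-back of a
   triple on the cube `↥W`, and (M⁺-3) pulls back.
So (M⁺-3) ON THE SMALL CUBE `↥W` (`CubeCombPos3 ↑W`) ⟹ (M⁺-3) FOR EVERY TRIPLE WHOSE PAIRWISE INTERSECTION `A ∩ B` IS DETERMINED BY `W`, in
every dimension (`combPos_sahiE_three_of_inter_determinedBy`).  With the kernel certificate (`cubeCombPos3_of_card_le_three`):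
**`combPos_sahiE_three_of_inter_determinedBy_card_le_three`** — unconditionally for `|W| ≤ 3` (standard axioms), with the law-level
(`sahiE_three_ind_nonneg_…`, every product measure) and three-partition (`threePartNT_nonneg_…`, every twist) corollaries.
Compare seat P4's `…SahiE3JuntaMeet` (measure level, conditional on block hypotheses (C3W),(TanA),(TanB)) and `…SahiE3DeterminedMeetFKG`
(`|W| ≤ 3`, every FKG weight): here product measures, COEFFICIENTWISE, hypothesis (C3W) only (domination makes (TanA)/(TanB) redundant).
-/

noncomputable section

open scoped Classical

namespace Summit.CriticalPhenomena.PercolationContinuityZ3.Theorems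

namespace SahiCombJunta

open Finset Function
open Literature.Combinatorics.Sahi2008
open Literature.Probability.Percolation (DeterminedBy determinedBy_iff)
open Literature.Probability.Percolation.DecisionTree (ind ind_of_mem ind_of_not_mem ind_nonneg)
open SahiComb

variable {ι : Type} [Fintype ι]

/-! ### Peeling the free slot -/

omit [Fintype ι] in
/-- A section at a coordinate off the determining set does nothing. [folklore] -/
theorem secAt_eq_self_of_determinedBy {X : Set (Set ι)} {F : Set ι} (hX : DeterminedBy X F) {e : ι} (he : e ∉ F) (b : Bool) :
    secAt e b X = X := by
  ext ω
  rw [mem_secAt]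
  exact (determinedBy_iff X F).1 hX _ _ (forceAt_inter_of_notMem b ω he)

/-- **First-slot peeling**: if `A', B'` ignore the coordinate `e` then
`E₃(μ_p; 1_U,1_{A'},1_{B'}) = p_e·E₃(μ_p; 1_{U^{e←1}},1_{A'},1_{B'}) + (1−p_e)·E₃(μ_p; 1_{U^{e←0}},1_{A'},1_{B'})`. [this work] -/
theorem sahiE_three_peel (p : ι → unitInterval) (e : ι) {U A' B' : Set (Set ι)} {F : Set ι} (hA' : DeterminedBy A' F)
    (hB' : DeterminedBy B' F) (he : e ∉ F) :
    sahiE (bernoulliWeight p) 3 ![ind U, ind A', ind B'] =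
      (p e : ℝ) * sahiE (bernoulliWeight p) 3 ![ind (secAt e true U), ind A', ind B']
        + (1 - (p e : ℝ)) * sahiE (bernoulliWeight p) 3 ![ind (secAt e false U), ind A', ind B'] := by
  have hA1 : ∀ b, secAt e b A' = A' := fun b => secAt_eq_self_of_determinedBy hA' he b
  have hB1 : ∀ b, secAt e b B' = B' := fun b => secAt_eq_self_of_determinedBy hB' he b
  rw [sahiE_three, sahiE_three, sahiE_three]
  simp only [ind_mul_ind_eq_inter]
  rw [ex_ind_eq_secAt p e (U ∩ A' ∩ B'), ex_ind_eq_secAt p e U, ex_ind_eq_secAt p e (U ∩ B'), ex_ind_eq_secAt p e (U ∩ A')]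
  simp only [secAt_inter, hA1, hB1]
  ring

/-- Moments of `e`-ignoring events do not depend on `p_e`. [folklore] -/
theorem ex_ind_update_of_determinedBy (p : ι → unitInterval) (e : ι) (s : unitInterval) {X : Set (Set ι)} {F : Set ι}
    (hX : DeterminedBy X F) (he : e ∉ F) :
    ex (bernoulliWeight (update p e s)) (ind X) = ex (bernoulliWeight p) (ind X) := by
  rw [← secAt_eq_self_of_determinedBy hX he true]
  exact ex_ind_secAt_update p e true X s

omit [Fintype ι] in
/-- Sections at `e` are determined by a set not containing `e` (namely everything else). [folklore] -/
theorem determinedBy_secAt_compl (e : ι) (b : Bool) (U : Set (Set ι)) : DeterminedBy (secAt e b U) ({e}ᶜ : Set ι) := by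
  rw [determinedBy_iff]
  intro ω ω' h
  rw [mem_secAt, mem_secAt]
  have key : forceAt e b ω = forceAt e b ω' := by
    ext x
    by_cases hx : x = e
    · subst hx; cases b <;> simp [forceAt]
    · have hx' : x ∈ ({e}ᶜ : Set ι) := hx
      have := Set.ext_iff.1 h x
      simp only [Set.mem_inter_iff, hx', and_true] at this
      cases b <;> simp [forceAt, hx, this]
  rw [key]

omit [Fintype ι] in
/-- Intersections of events determined by `F` and `G` are determined by `F ∪ G`. [folklore] -/
theorem determinedBy_inter {X Y : Set (Set ι)} {F G : Set ι} (hX : DeterminedBy X F) (hY : DeterminedBy Y G) :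
    DeterminedBy (X ∩ Y) (F ∪ G) := by
  rw [determinedBy_iff] at hX hY ⊢
  intro ω ω' h
  have hF : ω ∩ F = ω' ∩ F := by
    ext x; have := Set.ext_iff.1 h x; simp only [Set.mem_inter_iff, Set.mem_union] at this ⊢; tauto
  have hG : ω ∩ G = ω' ∩ G := by
    ext x; have := Set.ext_iff.1 h x; simp only [Set.mem_inter_iff, Set.mem_union] at this ⊢; tauto
  rw [Set.mem_inter_iff, Set.mem_inter_iff, hX ω ω' hF, hY ω ω' hG]

/-- `E₃` of `e`-ignoring events ignores `p_e`. [this work] -/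
theorem sahiE_three_update_of_determinedBy (p : ι → unitInterval) (e : ι) (s : unitInterval) {X Y Z : Set (Set ι)}
    {F G H : Set ι} (hX : DeterminedBy X F) (hY : DeterminedBy Y G) (hZ : DeterminedBy Z H) (heF : e ∉ F) (heG : e ∉ G)
    (heH : e ∉ H) :
    sahiE (bernoulliWeight (update p e s)) 3 ![ind X, ind Y, ind Z] = sahiE (bernoulliWeight p) 3 ![ind X, ind Y, ind Z] := by
  have hFG : e ∉ F ∪ G := fun h => h.elim heF heG
  have hFH : e ∉ F ∪ H := fun h => h.elim heF heH
  have hGH : e ∉ G ∪ H := fun h => h.elim heG heH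
  have hFGH : e ∉ (F ∪ G) ∪ H := fun h => h.elim hFG heH
  rw [sahiE_three, sahiE_three]
  simp only [ind_mul_ind_eq_inter]
  rw [ex_ind_update_of_determinedBy p e s (determinedBy_inter (determinedBy_inter hX hY) hZ) hFGH,
    ex_ind_update_of_determinedBy p e s hX heF, ex_ind_update_of_determinedBy p e s hY heG,
    ex_ind_update_of_determinedBy p e s hZ heH, ex_ind_update_of_determinedBy p e s (determinedBy_inter hY hZ) hGH,
    ex_ind_update_of_determinedBy p e s (determinedBy_inter hX hZ) hFH,
    ex_ind_update_of_determinedBy p e s (determinedBy_inter hX hY) hFG]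

/-! ### The induction on the free slot -/

/-- **Peeling the free slot.**  If (M⁺-3) holds for all triples of increasing `W`-determined events (`W : Finset ι`), then it holds for
`(U, A', B')` with `A', B'` increasing and `W`-determined and `U` ANY increasing event.  Induction on a finset `T` with `U` determined by
`W ∪ T`, conditioning on one coordinate of `T ∖ W` at a time (`sahiE_three_peel`). [this work] -/
theorem combPos_sahiE_three_of_determinedBy_pair (W : Finset ι)
    (hbase : ∀ X Y Z : Set (Set ι), IsUpperSet X → IsUpperSet Y → IsUpperSet Z → DeterminedBy X (↑W : Set ι) →
      DeterminedBy Y (↑W : Set ι) → DeterminedBy Z (↑W : Set ι) →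
      CombPos (fun _ : ι => 3) (fun p => sahiE (bernoulliWeight p) 3 ![ind X, ind Y, ind Z]))
    {A' B' : Set (Set ι)} (hA' : IsUpperSet A') (hB' : IsUpperSet B') (hA'd : DeterminedBy A' (↑W : Set ι))
    (hB'd : DeterminedBy B' (↑W : Set ι)) :
    ∀ (T : Finset ι) (U : Set (Set ι)), IsUpperSet U → DeterminedBy U (↑(W ∪ T) : Set ι) →
      CombPos (fun _ : ι => 3) (fun p => sahiE (bernoulliWeight p) 3 ![ind U, ind A', ind B']) := by
  intro T
  induction T using Finset.induction_on with
  | empty =>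
    intro U hU hUd
    rw [Finset.union_empty] at hUd
    exact hbase U A' B' hU hA' hB' hUd hA'd hB'd
  | insert e T heT ih =>
    intro U hU hUd
    by_cases heW : e ∈ W
    · refine ih U hU ?_
      have : W ∪ insert e T = W ∪ T := by
        ext x; simp only [Finset.mem_union, Finset.mem_insert]
        constructor
        · rintro (hx | rfl | hx)
          · exact Or.inl hx
          · exact Or.inl heW
          · exact Or.inr hx
        · rintro (hx | hx)
          · exact Or.inl hx
          · exact Or.inr (Or.inr hx)
      rwa [this] at hUd
    · -- condition on the coordinate `e ∉ W`
      have heWT : e ∉ W ∪ T := by simp [heW, heT]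
      have hsec : ∀ b : Bool, IsUpperSet (secAt e b U) ∧ DeterminedBy (secAt e b U) (↑(W ∪ T) : Set ι) := fun b => by
        refine ⟨isUpperSet_secAt e b hU, ?_⟩
        have h := determinedBy_secAt e b hUd
        have hE : (W ∪ insert e T).erase e = W ∪ T := by
          rw [Finset.union_insert, Finset.erase_insert heWT]
        rwa [hE] at h
      have hrec : ∀ b : Bool, CombPos (update (fun _ : ι => 3) e 0)
          (fun p => sahiE (bernoulliWeight p) 3 ![ind (secAt e b U), ind A', ind B']) := fun b =>
        (ih (secAt e b U) (hsec b).1 (hsec b).2).of_ignores e fun p s =>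
          sahiE_three_update_of_determinedBy p e s (hsec b).2 hA'd hB'd
            (by simpa using heWT) (by simpa using heW) (by simpa using heW)
      have hpe : CombPos (Pi.single e 1) (fun p : ι → unitInterval => (p e : ℝ)) := combPos_coord e
      have hqe : CombPos (Pi.single e 1) (fun p : ι → unitInterval => 1 - (p e : ℝ)) := combPos_one_sub_coord e
      have hdeg : Pi.single e 1 + update (fun _ : ι => 3) e 0 ≤ fun _ : ι => 3 := by
        intro x
        by_cases hx : x = e
        · subst hx; simp
        · simp [hx]
      exact ((hpe.mul_of_le (hrec true) hdeg).add (hqe.mul_of_le (hrec false) hdeg)).congr fun p =>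
        sahiE_three_peel p e hA'd hB'd (by simpa using heW)

/-- **(M⁺-3) on the small cube ⟹ (M⁺-3) for every triple `(U, A', B')` with `A', B'` determined by `W`** (any increasing `U`,
any dimension). [this work] -/
theorem combPos_sahiE_three_of_pair_determinedBy (W : Finset ι) (hcube : CubeCombPos3 (↑W : Set ι))
    {U A' B' : Set (Set ι)} (hU : IsUpperSet U) (hA' : IsUpperSet A') (hB' : IsUpperSet B') (hA'd : DeterminedBy A' (↑W : Set ι))
    (hB'd : DeterminedBy B' (↑W : Set ι)) :
    CombPos (fun _ : ι => 3) (fun p => sahiE (bernoulliWeight p) 3 ![ind U, ind A', ind B']) := by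
  have hbase : ∀ X Y Z : Set (Set ι), IsUpperSet X → IsUpperSet Y → IsUpperSet Z → DeterminedBy X (↑W : Set ι) →
      DeterminedBy Y (↑W : Set ι) → DeterminedBy Z (↑W : Set ι) →
      CombPos (fun _ : ι => 3) (fun p => sahiE (bernoulliWeight p) 3 ![ind X, ind Y, ind Z]) :=
    fun X Y Z hX hY hZ hXd hYd hZd => combPos_sahiE_three_of_determinedBy_all (↑W : Set ι) hcube hX hY hZ hXd hYd hZd
  have hUd : DeterminedBy U (↑(W ∪ Finset.univ) : Set ι) := by
    rw [determinedBy_iff]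
    intro ω ω' h
    have : ω = ω' := by simpa using h
    rw [this]
  exact combPos_sahiE_three_of_determinedBy_pair W hbase hA' hB' hA'd hB'd Finset.univ U hU hUd

/-! ### The junta-intersection theorem -/

omit [Fintype ι] in
/-- A `W`-determined event is unchanged by freezing the coordinates off `W`: `X^{Wᶜ} = X`. [this work] -/
theorem secUnion_eq_self_of_determinedBy {X : Set (Set ι)} {W : Set ι} (hX : DeterminedBy X W) : secUnion Wᶜ X = X := by
  ext ω
  rw [mem_secUnion]
  refine (determinedBy_iff X W).1 hX _ _ ?_
  ext x
  simp only [Set.mem_inter_iff, Set.mem_union, Set.mem_compl_iff]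
  tauto

/-- **THE JUNTA-INTERSECTION THEOREM (comb level, dimension-free).**  Let `W : Finset ι` be a set of coordinates on whose cube `↥W` the
comb form (M⁺-3) of Sahi's `C₃` holds for all triples of increasing events.  Then for all increasing `U, A, B ⊆ 2^ι` such that `A ∩ B`
is determined by `W`, `p ↦ E₃(μ_p; 1_U,1_A,1_B)` is comb-positive at multidegree `3`.  Proof: domination
(`…SahiCombDomination`) by the `W`-determined pair `(A^{Wᶜ}, B^{Wᶜ})`, then peeling of `U` and sub-cube transport. [this work] -/
theorem combPos_sahiE_three_of_inter_determinedBy (W : Finset ι) (hcube : CubeCombPos3 (↑W : Set ι))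
    {U A B : Set (Set ι)} (hU : IsUpperSet U) (hA : IsUpperSet A) (hB : IsUpperSet B)
    (hK : DeterminedBy (A ∩ B) (↑W : Set ι)) :
    CombPos (fun _ : ι => 3) (fun p => sahiE (bernoulliWeight p) 3 ![ind U, ind A, ind B]) := by
  set D : Set ι := (↑W : Set ι)ᶜ with hD
  have hAd : DeterminedBy (secUnion D A) (↑W : Set ι) := by
    simpa [hD] using SahiCombPrincipalMeet.determinedBy_secUnion D A
  have hBd : DeterminedBy (secUnion D B) (↑W : Set ι) := by
    simpa [hD] using SahiCombPrincipalMeet.determinedBy_secUnion D B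
  have hKeq : secUnion D A ∩ secUnion D B = A ∩ B := by
    rw [← secUnion_inter, hD, secUnion_eq_self_of_determinedBy hK]
  exact SahiCombDomination.combPos_sahiE_three_of_enlarge hU (isUpperSet_secUnion D hA) (isUpperSet_secUnion D hB)
    (subset_secUnion D hA) (subset_secUnion D hB) hKeq
    (combPos_sahiE_three_of_pair_determinedBy W hcube hU (isUpperSet_secUnion D hA) (isUpperSet_secUnion D hB) hAd hBd)

/-- **Unconditionally for `|W| ≤ 3`** (standard axioms; kernel certificate `…SahiC3CombCube`): if `A ∩ B` is determined by at most three
coordinates then (M⁺-3) holds for `(U,A,B)` for every increasing `U`, in every dimension. [this work] -/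
theorem combPos_sahiE_three_of_inter_determinedBy_card_le_three (W : Finset ι) (hW : W.card ≤ 3) {U A B : Set (Set ι)}
    (hU : IsUpperSet U) (hA : IsUpperSet A) (hB : IsUpperSet B) (hK : DeterminedBy (A ∩ B) (↑W : Set ι)) :
    CombPos (fun _ : ι => 3) (fun p => sahiE (bernoulliWeight p) 3 ![ind U, ind A, ind B]) :=
  combPos_sahiE_three_of_inter_determinedBy W (cubeCombPos3_of_card_le_three _ (by
    rw [← Set.toFinset_card, Finset.toFinset_coe]
    exact hW)) hU hA hB hK

/-- Law level: `E₃(μ_p; U, A, B) ≥ 0` whenever `A ∩ B` depends on at most three coordinates (every product measure, every dimension).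
[this work] -/
theorem sahiE_three_ind_nonneg_of_inter_determinedBy_card_le_three (p : ι → unitInterval) (W : Finset ι) (hW : W.card ≤ 3)
    {U A B : Set (Set ι)} (hU : IsUpperSet U) (hA : IsUpperSet A) (hB : IsUpperSet B) (hK : DeterminedBy (A ∩ B) (↑W : Set ι)) :
    0 ≤ sahiE (bernoulliWeight p) 3 ![ind U, ind A, ind B] :=
  (combPos_sahiE_three_of_inter_determinedBy_card_le_three W hW hU hA hB hK).nonneg p

/-- **(★★) on the junta-intersection class**: `threePartNT τ U A B ≥ 0` for every twist whenever `A ∩ B` depends on at most three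
coordinates. [this work] -/
theorem threePartNT_nonneg_of_inter_determinedBy_card_le_three (τ : Set ι) (W : Finset ι) (hW : W.card ≤ 3) {U A B : Set (Set ι)}
    (hU : IsUpperSet U) (hA : IsUpperSet A) (hB : IsUpperSet B) (hK : DeterminedBy (A ∩ B) (↑W : Set ι)) :
    0 ≤ ThreePartition.threePartNT τ U A B :=
  ThreePartition.threePartNT_nonneg_of_combPos τ (combPos_sahiE_three_of_inter_determinedBy_card_le_three W hW hU hA hB hK)

end SahiCombJunta

end Summit.CriticalPhenomena.PercolationContinuityZ3.Theorems
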